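import Summits.HodgeConjecture.HodgeConjecture.Theorems.F0P2oD7alphaMemDockOfRowsSignedW1      -- ROAD W (e): `stubD7αMemDockPerMeasureTW1_of_rowsSigned 𝔇 h hrecSW1` (the SIGNED-rows W1 producer)
import Summits.HodgeConjecture.HodgeConjecture.Theorems.F0P2oD7alphaShapeOfRecordSCDSigned     -- ★ p848493 (F0P2-p06 (g14)): `shape_xiPacketFamilyOfRecordSCD_of_packageTestSigned` (SIGNED SHAPE at the SCD record; unchanged under W1)
import HarnessLib

/-!
# Crux `H413`, programme P2 — (D7α) «D7αᵀ AT RUNG 0, DRY TERM, SIGNED, **WEIGHT-ONE AUTOMORPHIC LOCUS («W1»)**»: the W1 node `StubD7αMemDockPerMeasureTW1` AT THE ROWS OF A KIT FAMILY OF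
# RECORD WHOSE ξ-PACKETS ARE THE SCD RECORD AT THE SIGNED-PACKAGE DATUM — the closer supplies `keys`, `hQS`, (Ξ), Haar ×2, H₇, (D-b)ᵀˢ-W1 (ROAD W item (e); F0P2-ref1 r363∕r364)

Cell `hodgecm-mathlib` (D-0151), FLOOR 0, crux item H413 = `stmt-HodgeConjecture-24833`, route of record `HCCMUnconditional`; programme P2, fallback road PKΠ
`Cruxes/H413/Lines/F0_P2PKPiRung4.lean`.  ROAD W of the LH10 line (LH10-p02 (g0) 2026-09-02T03:19:42Z; F0P2-p06 (g14) census 03:24:26Z; F0P2-ref1 (g10) r363 (2)(3), r364 (3)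
«cut HOME-first, statement-first; FILE only on LEAD + director «v1.16 W1 GO»»).  Seat F0P2-p06 (g14).  Helper file: THEOREMS ONLY (no definition, no named fact, no instance, no
notation, no `sorry`); `--supports stmt-HodgeConjecture-24833 --as helper`; Lines-free.  HONEST LABEL: HC_CM is proved only modulo the printed citations (2 remaining named inputs
hLiu418 24832, h413 24833) until rung 0 closes; this file discharges none of them — its hypotheses are the closer's fourteen ROWS and, per (frame, μ), the rung-0 exports named below.

WHAT — the W1 twin of ★ p848524 `F0P2oD7alphaMemDockOfRowsSCDSigned.stubD7αMemDockPerMeasureT_of_rowsSCDSigned`: `hrecSCDSW1` = its `hrecSCDS` TEXT with EXACTLY ONE token changed,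
(H₈ᵀˢ) `piSCompletion_isThetaTypeAtCMTestSigned` ↦ `piSCompletion_isThetaTypeAtCMTestSignedW1` (ROAD W (b), LH10 — payable IN-HOUSE on the weight-one automorphic locus); conclusion
the W1 node (ROAD W (c)).  Proof = ROAD W (e) `stubD7αMemDockPerMeasureTW1_of_rowsSigned 𝔇 h` fed ★ `shape_xiPacketFamilyOfRecordSCD_of_packageTestSigned` transported along (Ξ)
(the SIGNED SHAPE is sign∕locus-independent — ★ p848493 unchanged); (H₅)–(H₈ᵀˢ-W1) passed through.

DAY-X TERM OF RECORD (ED. 2 note, doc-only; LEAD T12-32 (1)∕T12-36 (p5), F0P2-ref1 r378, LHref-S BOX LH10 #1∕#3): THIS file's `𝔇 : ∀ frame, FrameData …` is in the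
SIGN-BLIND kit currency, whereas the closer's record since AGG ED. 38 «PK-ε» is `F0U3LettersRung1.frameDataOfRung0 : ∀ frame, F0P3KitOfRecordW.FrameDataW …` with rows
`rows_of_rung0` on `kitFamilyOfRecordW` (and row #9 in the v8 GUARDED routing) — so the Day-X producer is NOT this file's theorem but its W twin ★ p849917
`Theorems/F0P2oD7alphaMemDockOfRowsSCDSignedW1W.lean :: stubD7αMemDockPerMeasureTW1_of_rowsSCDSignedW` (same proof bytes in the `FrameDataW`∕`kitFamilyOfRecordW` currency).  The
term that pays PKΠ v1.16 `stub_D7αMemDockμTW1` — typed BY IMPORT on the served closer ED. 41 «Δ‴-PINS EXPOSED» (F0P2-ref1 r378, `example : type_of%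
F0P2PKPiRung4.stub_D7αMemDockμTW1 := dayX_term_D7αTW1_v116`, rc 0) — reads: `F0P2oD7alphaMemDockOfRowsSCDSignedW1W.stubD7αMemDockPerMeasureTW1_of_rowsSCDSignedW
F0U3LettersRung1.frameDataOfRung0 F0U3LettersRung1.rows_of_rung0 (fun L ι H T hT hdef h2 μω hμu hμω μ _ => let C := F0U3LettersRung1.rung0Choice … hdef h2;
⟨C.𝔨.Δ, C.𝔨.mH, C.mG₀, C.W.νG, C.W.νH, C.W.μZ, C.W.isHaar_μZ, C.W.isHaar_νG, keysOfKeysCaseTwo …, C.hQ, rfl, ‹hex from C.hloc₀›, fun e₁ dV hdV hdV0 g hg ξ =>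
F0P3cDbTPaydown.Db_T_paidW1 … C.𝔨.Δ C.𝔨.mH C.mG₀ C.W.νG C.W.νH μω hμu hμω μ C.hΔ ⟨…, C.hcan₀ v⟩ C.hQ hex e₁ dV hdV hdV0 g hg ξ⟩)` — (Ξ) IS `rfl` (the rung-0 kit's ξ-side is built on
`hSCD_of_cmCharIdentityPackageTestSigned … C.hQ`), (G1)∕(G2b)∕(G3) are the `Rung0ChoicePinned` fields `C.hΔ`∕`C.hcan₀`∕`C.hloc₀` of closer ED. 41; what remains under that stub
is PRINT only (the rung-0 letters behind 27456 + LH10 O2♮).  This file stays the road-S∕sign-blind record; no declaration changed.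

References: [Rogawski1990] §12.2 (2) pp. 173–174; §13.1 Prop. 13.1.3 (d), Prop. 13.1.4 p. 199; §13.3 pp. 201–202; §4.9 Prop. 4.9.1 (a) p. 55; §14.6 p. 242.
[GelbartRogawski1991] Lem. 5.1.2 p. 466; Thm. 5.1.1 p. 465.  [Liu2021] Def. 4.11, Prop. 4.13.  [LanglandsShelstad1987] §1.
-/

set_option autoImplicit false
-- the mandated namespace repeats `HodgeConjecture.HodgeConjecture`, as in every `Theorems/*.lean` of this sub-problem
set_option linter.dupNamespace false

noncomputable section

open NumberField IsDedekindDomain MeasureTheory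
open scoped Matrix ComplexOrder

namespace Summit.HodgeConjecture.HodgeConjecture.Cruxes.H413.F0P2oD7alphaMemDockOfRowsSCDSignedW1

open Literature.NumberTheory.Rogawski1990 Literature.NumberTheory.GaloisRepresentations
open Literature.NumberTheory.Automorphic Literature.NumberTheory.Automorphic.UnitaryGroup
open Literature.NumberTheory.Automorphic.UnitaryGroup.CotangentForms
open Literature.RepresentationTheory.BorelWallach2000 Literature.RepresentationTheory.KonnoKonno2007
open Summit.HodgeConjecture.HodgeConjecture.Cruxes.H413.F0P3InnerFormClassificationV6 (Gp Places)
open Summit.HodgeConjecture.HodgeConjecture.Cruxes.H413.F0P3KitOfRecord (FrameData kitFamilyOfRecord)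
open Summit.HodgeConjecture.HodgeConjecture.Cruxes.H413.F0P3XiArchPacketOfRecord (JInfNoDegOne DsInfNoDegOne)

/-! ## The W1 node at the rows of a kit family of record whose ξ-packets are the SCD record at the SIGNED-package datum -/

section PerMeasureSCDSW1

variable
  (𝔇 : ∀ (L : Type) [Field L] [NumberField L] [IsCMField L] (ι : L →+* ℂ) (H : Matrix (Fin 3) (Fin 3) L) (T : GL (Fin 3) ℂ)
    (hT : (T : Matrix (Fin 3) (Fin 3) ℂ)ᴴ * H.map ι * (T : Matrix (Fin 3) (Fin 3) ℂ) = Literature.Geometry.ComplexHyperbolic.BallModel.J),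
    (∀ τ' : L →+* ℂ, InfinitePlace.mk τ' ≠ InfinitePlace.mk ι → (H.map τ').PosDef) →
    2 ≤ Module.finrank ℚ ↥(maximalRealSubfield L) →
    ∀ (μ : Measure (Gp L H).automorphicQuotient) [(Gp L H).IsAutomorphicMeasure μ] (μω : HeckeCharacter L) (_hμu : μω.IsUnitary),
    (∀ x : Literature.NumberTheory.GaloisRepresentations.ideleGroup ↥(maximalRealSubfield L),
      μω (AdeleRing.ideleBaseChange (↥(maximalRealSubfield L)) L x) = quadraticHeckeCharCM L x) → FrameData L H ι T hT μ)
  (h : ∀ (L : Type) [Field L] [NumberField L] [IsCMField L] (ι : L →+* ℂ) (H : Matrix (Fin 3) (Fin 3) L) (T : GL (Fin 3) ℂ)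
    (hT : (T : Matrix (Fin 3) (Fin 3) ℂ)ᴴ * H.map ι * (T : Matrix (Fin 3) (Fin 3) ℂ) = Literature.Geometry.ComplexHyperbolic.BallModel.J)
    (hdef : ∀ τ' : L →+* ℂ, InfinitePlace.mk τ' ≠ InfinitePlace.mk ι → (H.map τ').PosDef) (h2 : 2 ≤ Module.finrank ℚ ↥(maximalRealSubfield L))
    (μ : Measure (Gp L H).automorphicQuotient) [(Gp L H).IsAutomorphicMeasure μ] (μω : HeckeCharacter L) (hμu : μω.IsUnitary)
    (hμω : ∀ x : Literature.NumberTheory.GaloisRepresentations.ideleGroup ↥(maximalRealSubfield L),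
      μω (AdeleRing.ideleBaseChange (↥(maximalRealSubfield L)) L x) = quadraticHeckeCharCM L x),
    ∃ S₀ : Finset (Places L),
    F0P3InnerFormClassificationV8.ClassificationKit.SpecPkg (kitFamilyOfRecord 𝔇 L ι H T hT hdef h2 μ μω hμu hμω) S₀ ∧
    (kitFamilyOfRecord 𝔇 L ι H T hT hdef h2 μ μω hμu hμω).TraceIdentity ∧
    F0P3InnerFormClassificationV8.ClassificationKit.FactorisationCls (kitFamilyOfRecord 𝔇 L ι H T hT hdef h2 μ μω hμu hμω) S₀ ∧
    (kitFamilyOfRecord 𝔇 L ι H T hT hdef h2 μ μω hμu hμω).SpectralSideGp ∧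
    F0P3InnerFormClassificationV8.ClassificationKit.HatBounded (kitFamilyOfRecord 𝔇 L ι H T hT hdef h2 μ μω hμu hμω) S₀ ∧
    F0P3InnerFormClassificationV8.ClassificationKit.UnrStarAlgebra (kitFamilyOfRecord 𝔇 L ι H T hT hdef h2 μ μω hμu hμω) S₀ ∧
    (kitFamilyOfRecord 𝔇 L ι H T hT hdef h2 μ μω hμu hμω).LinIndepS ∧
    F0P3InnerFormClassificationV8.ClassificationKit.UnitaryPacket (kitFamilyOfRecord 𝔇 L ι H T hT hdef h2 μ μω hμu hμω) S₀ ∧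
    (kitFamilyOfRecord 𝔇 L ι H T hT hdef h2 μ μω hμu hμω).Routing ∧
    JInfNoDegOne (𝔇 L ι H T hT hdef h2 μ μω hμu hμω).jInf ∧ DsInfNoDegOne (𝔇 L ι H T hT hdef h2 μ μω hμu hμω).dsInf ∧
    (kitFamilyOfRecord 𝔇 L ι H T hT hdef h2 μ μω hμu hμω).XiFamilyFin μω hμu ∧
    (kitFamilyOfRecord 𝔇 L ι H T hT hdef h2 μ μω hμu hμω).XiUnram ∧
    (kitFamilyOfRecord 𝔇 L ι H T hT hdef h2 μ μω hμu hμω).EvpConvention)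

include h in
/-- **(D7α) «D7αᵀ AT RUNG 0, DRY TERM, SIGNED, W1»: the W1 node AT THE ROWS OF A KIT FAMILY OF RECORD WHOSE ξ-PACKETS ARE THE SCD RECORD AT THE SIGNED-PACKAGE DATUM.**  Per (frame, μ)
the closer supplies `(Δ, mH, mG, νG, νH, μZ)` (`Δ` = the factor of record `Δ‴`), the Keys handle `keys`, the SIGNED Test package `hQS`, the K-side identification (Ξ), Haar ×2, (H₇)
local Δ-transfer existence at non-split places and (H₈ᵀˢ-W1) the SIGNED letter (D-b)ᵀˢ RESTRICTED to the weight-one automorphic locus (`piSCompletion_isThetaTypeAtCMTestSignedW1`,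
BY NAME); conclusion the W1 node `StubD7αMemDockPerMeasureTW1` BY NAME.  The SIGNED SHAPE is ★ `shape_xiPacketFamilyOfRecordSCD_of_packageTestSigned` transported along (Ξ); everything
else is ROAD W (e) `stubD7αMemDockPerMeasureTW1_of_rowsSigned`.
[cite: Rogawski1990, §13.1 Prop. 13.1.3 (d), Prop. 13.1.4 p. 199; §12.2 (2) pp. 173–174; §14.6 p. 242] [cite: GelbartRogawski1991, Lem. 5.1.2 p. 466; Thm. 5.1.1 p. 465]
[cite: Liu2021, Def. 4.11, Prop. 4.13] [cite: LanglandsShelstad1987, §1] -/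
theorem stubD7αMemDockPerMeasureTW1_of_rowsSCDSigned
  (hrecSCDSW1 : ∀ (L : Type) [Field L] [NumberField L] [IsCMField L] (ι : L →+* ℂ) (H : Matrix (Fin 3) (Fin 3) L) (T : GL (Fin 3) ℂ)
    (hT : (T : Matrix (Fin 3) (Fin 3) ℂ)ᴴ * H.map ι * (T : Matrix (Fin 3) (Fin 3) ℂ) = Literature.Geometry.ComplexHyperbolic.BallModel.J)
    (hdef : ∀ τ' : L →+* ℂ, InfinitePlace.mk τ' ≠ InfinitePlace.mk ι → (H.map τ').PosDef) (h2 : 2 ≤ Module.finrank ℚ ↥(maximalRealSubfield L))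
    (μω : HeckeCharacter L) (hμu : μω.IsUnitary)
    (hμω : ∀ x : Literature.NumberTheory.GaloisRepresentations.ideleGroup ↥(maximalRealSubfield L), μω (AdeleRing.ideleBaseChange (↥(maximalRealSubfield L)) L x) = quadraticHeckeCharCM L x)
    (μ : Measure (adelicGroupData (↥(maximalRealSubfield L)) L (IsCMField.complexConj L) 3 H).automorphicQuotient) [(adelicGroupData (↥(maximalRealSubfield L)) L (IsCMField.complexConj L) 3 H).IsAutomorphicMeasure μ],
    letI : ∀ v : HeightOneSpectrum (𝓞 ↥(maximalRealSubfield L)), MeasurableSpace ((cmDatum L 3 H).Local v) := fun _ => borel _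
    letI : ∀ v : HeightOneSpectrum (𝓞 ↥(maximalRealSubfield L)),
        MeasurableSpace ((cmDatum L 2 (Matrix.of fun i j : Fin 2 => if i.val + j.val + 1 = 2 then (1 : L) else 0)).Local v ×
          (cmDatum L 1 (Matrix.of fun i j : Fin 1 => if i.val + j.val + 1 = 1 then (1 : L) else 0)).Local v) := fun _ => borel _
    letI : ∀ (v : HeightOneSpectrum (𝓞 ↥(maximalRealSubfield L)))
        (a : ((cmDatum L 2 (Matrix.of fun i j : Fin 2 => if i.val + j.val + 1 = 2 then (1 : L) else 0)).Local v ×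
          (cmDatum L 1 (Matrix.of fun i j : Fin 1 => if i.val + j.val + 1 = 1 then (1 : L) else 0)).Local v)),
        MeasurableSpace (((cmDatum L 2 (Matrix.of fun i j : Fin 2 => if i.val + j.val + 1 = 2 then (1 : L) else 0)).Local v ×
            (cmDatum L 1 (Matrix.of fun i j : Fin 1 => if i.val + j.val + 1 = 1 then (1 : L) else 0)).Local v) ⧸
          Subgroup.centralizer ({a} : Set ((cmDatum L 2 (Matrix.of fun i j : Fin 2 => if i.val + j.val + 1 = 2 then (1 : L) else 0)).Local v ×
            (cmDatum L 1 (Matrix.of fun i j : Fin 1 => if i.val + j.val + 1 = 1 then (1 : L) else 0)).Local v))) := fun _ _ => borel _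
    letI : ∀ (v : HeightOneSpectrum (𝓞 ↥(maximalRealSubfield L))) (γ : (cmDatum L 3 H).Local v),
        MeasurableSpace ((cmDatum L 3 H).Local v ⧸ Subgroup.centralizer ({γ} : Set ((cmDatum L 3 H).Local v))) := fun _ _ => borel _
    letI : ∀ v : HeightOneSpectrum (𝓞 ↥(maximalRealSubfield L)), MeasurableSpace (Gqs L v ⧸ Subgroup.center (Gqs L v)) := fun _ => borel _
    ∃ (Δ : ∀ v : HeightOneSpectrum (𝓞 ↥(maximalRealSubfield L)), LocalTransferFactor L H v)
      (mH : ∀ v : HeightOneSpectrum (𝓞 ↥(maximalRealSubfield L)),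
    OrbitalMeasureFamily ((cmDatum L 2 (Matrix.of fun i j : Fin 2 => if i.val + j.val + 1 = 2 then (1 : L) else 0)).Local v ×
      (cmDatum L 1 (Matrix.of fun i j : Fin 1 => if i.val + j.val + 1 = 1 then (1 : L) else 0)).Local v))
      (mG : ∀ v : HeightOneSpectrum (𝓞 ↥(maximalRealSubfield L)), OrbitalMeasureFamily ((cmDatum L 3 H).Local v))
      (νG : ∀ v : HeightOneSpectrum (𝓞 ↥(maximalRealSubfield L)), Measure ((cmDatum L 3 H).Local v))
      (νH : ∀ v : HeightOneSpectrum (𝓞 ↥(maximalRealSubfield L)),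
    Measure ((cmDatum L 2 (Matrix.of fun i j : Fin 2 => if i.val + j.val + 1 = 2 then (1 : L) else 0)).Local v ×
      (cmDatum L 1 (Matrix.of fun i j : Fin 1 => if i.val + j.val + 1 = 1 then (1 : L) else 0)).Local v))
      (μZ : ∀ v : HeightOneSpectrum (𝓞 ↥(maximalRealSubfield L)), Measure (Gqs L v ⧸ Subgroup.center (Gqs L v))),
      -- (K) THE KEYS HANDLE and (Qᵀˢ) THE SIGNED TEST PACKAGE at these data (the closer's rung-0 exports `keys`, `hQS` — edition «QCMT SIGNED»), and
      -- (Ξ) the K-side identification: the kit family's finite ξ-packets ARE the SCD record at the datum read off `hQS` (★ `hSCD_of_cmCharIdentityPackageTestSigned`)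
      ∃ (hHaar : ∀ v : HeightOneSpectrum (𝓞 ↥(maximalRealSubfield L)), (μZ v).IsHaarMeasure)
        (_hνG : ∀ v : HeightOneSpectrum (𝓞 ↥(maximalRealSubfield L)), (νG v).IsHaarMeasure)
        (keys : ∀ (ξ : OneDimAutRepH L) (v : HeightOneSpectrum (𝓞 ↥(maximalRealSubfield L))),
        (∀ w : PlacesOver L v, IsCMField.complexConj L • w.1 = w.1) →
          {p : IrrClass (Gqs L v) × IrrClass (Gqs L v) //
            KeysCaseTwoLabels L v (μω.semilocalComponent L v) (torusLocalComponent L (IsCMField.complexConj L) v ξ.η)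
              (torusLocalComponent L (IsCMField.complexConj L) v ξ.ψ) p.1 p.2 ∧
            p.1.IsSquareIntegrable (μZ v) ∧ ¬ p.2.IsSquareIntegrable (μZ v)})
      (hQS : CMCharIdentityPackageTestSigned L H (transpose_map_cmConjRingHom_eq_of_frame L ι H T hT) (isUnit_det_of_frame L ι H T hT) νH νG μω hμu Δ mH mG),
      (haveI : ∀ v : HeightOneSpectrum (𝓞 ↥(maximalRealSubfield L)), (μZ v).IsHaarMeasure := hHaar
       haveI : ∀ v : HeightOneSpectrum (𝓞 ↥(maximalRealSubfield L)), BorelSpace (Gqs L v ⧸ Subgroup.center (Gqs L v)) := fun _ => ⟨rfl⟩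
       (kitFamilyOfRecord 𝔇 L ι H T hT hdef h2 μ μω hμu hμω).packFin =
        F0P3XiPacketFamilyOfRecordSCD.xiPacketFamilyOfRecordSCD L H (transpose_map_cmConjRingHom_eq_of_frame L ι H T hT) (isUnit_det_of_frame L ι H T hT)
          μω hμu μZ keys
          (F0P3XiPacketFamilyOfRecordSCD.hSCD_of_cmCharIdentityPackageTestSigned L H (transpose_map_cmConjRingHom_eq_of_frame L ι H T hT)
            (isUnit_det_of_frame L ι H T hT) μω hμu Δ mH mG νG νH μZ hQS)) ∧
      -- (H₇) `φ ↦ φ^H` exists on `C_c^∞` at every non-split finite place [Rogawski1990 Prop. 4.9.1 (a)] (the N6 #102 currency), at `Δ`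
      (∀ v : HeightOneSpectrum (𝓞 ↥(maximalRealSubfield L)), (∀ w : PlacesOver L v, IsCMField.complexConj L • w.1 = w.1) →
        IsLocalDeltaTransferExists L H v (Δ v) (mH v) (mG v) Literature.NumberTheory.Rogawski1990.IsLocSmooth
          Literature.NumberTheory.Rogawski1990.IsLocSmooth) ∧
      -- (H₈ᵀˢ-W1) the SIGNED letter (D-b)ᵀˢ RESTRICTED TO THE WEIGHT-ONE AUTOMORPHIC LOCUS, BY NAME, at these data (in-house payable: LH10 ROAD W)
      (∀ {n' : ℕ} (e₁ : Fin 3 × Fin 1 ≃ Fin n') (dV : Fin 3 → L) (hdV : ∀ i, IsCMField.complexConj L (dV i) = dV i) (hdV0 : ∀ i, dV i ≠ 0) (g : GL (Fin 3) L)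
          (hg : ((g : Matrix (Fin 3) (Fin 3) L).map (cmConjRingHom L))ᵀ * H * (g : Matrix (Fin 3) (Fin 3) L) = Matrix.diagonal dV) (ξ : OneDimAutRepH L),
        Literature.NumberTheory.GelbartRogawski1991.piSCompletion_isThetaTypeAtCMTestSignedW1 L H Δ mH mG νH νG ξ μω (fun v => ξ.xiLocalChar v) e₁ dV hdV hdV0 g hg)) :
    F0P2oD7alphaMemDockStatementW1.StubD7αMemDockPerMeasureTW1 := by
  refine F0P2oD7alphaMemDockOfRowsSignedW1.stubD7αMemDockPerMeasureTW1_of_rowsSigned 𝔇 h ?_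
  intro L _ _ _ ι H T hT hdef h2 μω hμu hμω μ _
  obtain ⟨Δ, mH, mG, νG, νH, μZ, hHaar, hνG, keys, hQS, hpk, hex, hW⟩ := hrecSCDSW1 L ι H T hT hdef h2 μω hμu hμω μ
  refine ⟨Δ, mH, mG, νG, νH, μZ, ?_, hHaar, hνG, hex, hW⟩
  -- SIGNED SHAPE at the SCD record (signed-package datum), transported along the K-side identification (Ξ); borel σ-algebras as in the node's `letI`s
  intro ξ v hns
  letI : ∀ v : HeightOneSpectrum (𝓞 ↥(maximalRealSubfield L)), MeasurableSpace ((cmDatum L 3 H).Local v) := fun _ => borel _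
  letI : ∀ v : HeightOneSpectrum (𝓞 ↥(maximalRealSubfield L)),
      MeasurableSpace ((cmDatum L 2 (Matrix.of fun i j : Fin 2 => if i.val + j.val + 1 = 2 then (1 : L) else 0)).Local v ×
        (cmDatum L 1 (Matrix.of fun i j : Fin 1 => if i.val + j.val + 1 = 1 then (1 : L) else 0)).Local v) := fun _ => borel _
  letI : ∀ (v : HeightOneSpectrum (𝓞 ↥(maximalRealSubfield L)))
      (a : ((cmDatum L 2 (Matrix.of fun i j : Fin 2 => if i.val + j.val + 1 = 2 then (1 : L) else 0)).Local v ×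
        (cmDatum L 1 (Matrix.of fun i j : Fin 1 => if i.val + j.val + 1 = 1 then (1 : L) else 0)).Local v)),
      MeasurableSpace (((cmDatum L 2 (Matrix.of fun i j : Fin 2 => if i.val + j.val + 1 = 2 then (1 : L) else 0)).Local v ×
          (cmDatum L 1 (Matrix.of fun i j : Fin 1 => if i.val + j.val + 1 = 1 then (1 : L) else 0)).Local v) ⧸
        Subgroup.centralizer ({a} : Set ((cmDatum L 2 (Matrix.of fun i j : Fin 2 => if i.val + j.val + 1 = 2 then (1 : L) else 0)).Local v ×
          (cmDatum L 1 (Matrix.of fun i j : Fin 1 => if i.val + j.val + 1 = 1 then (1 : L) else 0)).Local v))) := fun _ _ => borel _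
  letI : ∀ (v : HeightOneSpectrum (𝓞 ↥(maximalRealSubfield L))) (γ : (cmDatum L 3 H).Local v),
      MeasurableSpace ((cmDatum L 3 H).Local v ⧸ Subgroup.centralizer ({γ} : Set ((cmDatum L 3 H).Local v))) := fun _ _ => borel _
  letI : ∀ v : HeightOneSpectrum (𝓞 ↥(maximalRealSubfield L)), MeasurableSpace (Gqs L v ⧸ Subgroup.center (Gqs L v)) := fun _ => borel _
  haveI : ∀ v : HeightOneSpectrum (𝓞 ↥(maximalRealSubfield L)), BorelSpace (Gqs L v ⧸ Subgroup.center (Gqs L v)) := fun _ => ⟨rfl⟩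
  haveI : ∀ v : HeightOneSpectrum (𝓞 ↥(maximalRealSubfield L)), (μZ v).IsHaarMeasure := hHaar
  obtain ⟨Tv, a, ha, hc, π2, πn, πs, hK, hs2, hn, hsc, hne, hId, hP⟩ :=
    F0P2oD7alphaShapeOfRecordSCDSigned.shape_xiPacketFamilyOfRecordSCD_of_packageTestSigned L H (transpose_map_cmConjRingHom_eq_of_frame L ι H T hT)
      (isUnit_det_of_frame L ι H T hT) μω hμu Δ mH mG νG νH μZ keys hQS ξ v hns
  exact ⟨Tv, a, ha, hc, π2, πn, πs, hK, hs2, hn, hsc, hne, hId, by rw [hpk]; exact hP⟩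

end PerMeasureSCDSW1

end Summit.HodgeConjecture.HodgeConjecture.Cruxes.H413.F0P2oD7alphaMemDockOfRowsSCDSignedW1

end
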